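import Summits.BirchSwinnertonDyer.BirchSwinnertonDyer.Theorems.AdditiveKolyvaginRoadLevelSystemsCanonicalLines
import Summits.BirchSwinnertonDyer.BirchSwinnertonDyer.Theorems.AdditiveKolyvaginRoadLevelSystemsEvenLevels
import HarnessLib

/-!
# Route `AdditiveKolyvaginRoad`, crux `LevelKolyvaginSystemsAdditive` (item stmt-BirchSwinnertonDyer-21396, KS′):
# KS′'s conclusion at a frame FROM ONE SEED — the level Kolyvagin system of CANONICAL LINES
# (cell `pub/bsd-wall`, width seat `bsd-wall-akr-p2x-w3` g7; `--supports stmt-BirchSwinnertonDyer-21396`, helper; instantiation of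
# `…LevelSystemsCanonicalLines` against the fields of `LevelKolyvaginSystemP`)

WHY. Crux-triage seat 1 (v17 §1–§2) observed that the crux's structure AS TYPED carries no geometric content above level `∅`:
`LevelKolyvaginSystemP W K p Dt β ι c` asks for the frame's actual Kolyvagin classes only at level `n = ∅` (`realisation`), where the
only constraint is `transport` at `n = ∅` («some class `κ m ∅ ≠ 0`» — ONE SEED), while every row at a non-empty level is a statement
about the MIXED level spaces `S(m, n)^μ` (E's Kummer condition off `m ∪ n`, TORIC on `n`, TRANSVERSE on `m`, sign `μ`). This file
kernel-checks that reading: given ANY family `S m n μ` of `𝔽_p`-subspaces of `H¹(K, E[p])` which (S∅) is the canonical space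
`SelQP … n μ` at conductor `∅`, (Mem) unpacks to the structure's local rows, (Fin) is finite-dimensional, and satisfies at every
NON-EMPTY level the TWIN DICHOTOMY at Kolyvagin primes — (Z) agreement away from `λ`, (Det) detected ⟹ strict, (Jump) undetected ⟹
a class of the raised conductor is seen at `λ`, (Line) line-rigidity at `λ` — together with the Čebotarev supplies (Cheb1) ∕ (Cheb2)
for Kolyvagin primes (tree THEOREMS `chebOne_of_mcCallum_P` ∕ `chebTwo_of_mcCallum_P`, here binders in place currency), ONE place above
each Kolyvagin prime (Uniq), the level PARITY at conductor `∅` (odd total rank at even levels — tree `CoreGraph.odd_total_iff_even_card`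
+ (Inert)(Lower)(Raise)), Kolyvagin–Heegner data at every conductor and ONE SEED (a non-zero mod-`p` Kolyvagin class at SOME conductor):
`Nonempty (LevelKolyvaginSystemP W K p Dt β ι c)` — the conclusion of KS′ at the frame. The classes: at `n = ∅` the frame's classes
(the seed's datum at its conductor); at `n ≠ ∅` the CANONICAL LINES of `…CanonicalLines` (a generator at every core, `0` elsewhere);
`sign` by `odd_finrank_empty_iff_even_card_of_core`, the local rows by (Mem), `relation` by `mem_iff_mem_of_canonicalLines` + (Uniq),
`transport` at `n = ∅` by the seed and at even `n ≠ ∅` by core descent (`exists_core_superset_of_odd`), `baseCase` because a core's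
canonical line is non-zero; odd levels are filled with `0` by w2's `nonempty_levelKolyvaginSystemP_of_evenLevels`.

CONSEQUENCES (informal, for the planners; nothing of this is claimed here). (i) On line `epsilon_matched_retyping` (skeleton v9) the
DISPLAYED W. Zhang datum of a GOOD avatar `E₀` is replaceable by the twin-dichotomy binders for `E₀` — its log certificate IS the seed
(`stub_lenderSeed`). (ii) Route-level: KS′ at a frame ⟸ KPA′-type seed at that frame + the same binders («KS′ ≡ KPA′ modulo E-side
bookkeeping», triage v17 §1). The binders (Z) (Det) (Line) are assemblies of landed local facts (`torsionLocalKer_le_transverseLocalKerP`,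
(REC) + (Perf) `cupProduct_ne_zero_of_selmer_of_transverse_P`, (IsoBound) `sub_zsmul_mem_torsionLocalKer_of_isotropic_P`) once the mixed
space is a definition; (Jump) is the Poitou–Tate jump (`hjump_of_poitouTateP`) PLUS the local axis lemma «an isotropic ramified
eigenclass at a Kolyvagin prime is transverse» (Frobenius-value half in the tree: `apply_frob_eq_zero_of_self_cup_eq_zero_P`) — the one
binder with new local content.

HONEST FRAMING: one theorem; 0 definitions, 0 named facts, 0 `sorry`; every producer-shape statement is a HYPOTHESIS; CONDITIONAL;
closes nothing. BSD is not proved by any of this; KS′ (∀ frames) is not proved by any of this.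

References: [cite: WZhang2014, §3.7, §8.1 (8.1), Def. 8.3, Thm. 4.3, Thm. 7.2, §9] [cite: Howard2004HeegnerKolyvagin, Thm. 1.6.1]
[cite: MazurRubin2004, Lemma 4.1.7, Thm. 4.4.1] [cite: GrossLMS1991, Prop. 6.2] [cite: McCallumLMS1991, Cor. 3.2].
-/

-- single-conjunct summit: `Summit.BirchSwinnertonDyer.BirchSwinnertonDyer.…` repeats the name by design
set_option linter.dupNamespace false

noncomputable section

open scoped Classical

namespace Summit.BirchSwinnertonDyer.BirchSwinnertonDyer.Theorems.AdditiveKoly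

open WeierstrassCurve NumberField IsDedekindDomain
  Literature.NumberTheory.EllipticCurves Literature.NumberTheory.EllipticCurves.ModularForms
  Literature.NumberTheory.EllipticCurves.Rank1Residual Literature.NumberTheory.GaloisRepresentations Module
  Summit.BirchSwinnertonDyer.Rank1Residual.X11b.Three.Koly

variable (W : WeierstrassCurve ℚ) (K : Type) [Field K] [NumberField K] (p : ℕ) [W.IsGloballyMinimal]
  [NeZero (W.conductorNorm ℤ)] [Fact p.Prime] (c : K ≃ₐ[ℚ] K) [Module (ZMod p) (Vp W K p)]
  (Dt : ModularParametrizationData W (W.conductorNorm ℤ)) (β : ℤ) (ι : K →+* ℂ)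

/-- **KS′'s conclusion at a frame from ONE SEED, by canonical lines.** For ANY family `S m n μ ⊂ H¹(K, E[p])` of mixed level spaces
— (S∅) equal to `SelQP … n μ` at conductor `∅`, (Mem) unpacking to the sign ∕ Kummer-off ∕ Kummer-at-∞ ∕ toric-on-`n` ∕ transverse-on-`m`
rows, (Fin) finite-dimensional — satisfying at every non-empty level the TWIN DICHOTOMY at Kolyvagin primes ((Z) (Det) (Jump) (Line), per
place above the prime) and the Čebotarev supplies (Cheb1) (Cheb2), with (Uniq) one place above each Kolyvagin prime, (Par) odd total rank of
`Sel_n^±` at non-empty even levels, Kolyvagin–Heegner data at every conductor and ONE SEED `c(∏ m₀) ≢ 0 (mod p)`: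
`Nonempty (LevelKolyvaginSystemP W K p Dt β ι c)`. Classes: the frame's at level `∅`, canonical lines above. CONDITIONAL on the displayed
binders; closes nothing. [cite: WZhang2014, §8.1 (8.1), Thm. 4.3, Thm. 7.2] [cite: Howard2004HeegnerKolyvagin, Thm. 1.6.1]
[cite: MazurRubin2004, Lemma 4.1.7, Thm. 4.4.1] [cite: McCallumLMS1991, Cor. 3.2] -/
theorem nonempty_levelKolyvaginSystemP_of_seed_of_twinDichotomy
    (S : Finset {ℓ // Zhang2014.IsKolyvaginPrime (W.conductorNorm ℤ) W K p ℓ} → Finset (AdmQ W K p) → Bool →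
      Submodule (ZMod p) (Vp W K p))
    (hS0 : ∀ (n : Finset (AdmQ W K p)) (μ : Bool), S ∅ n μ = SelQP W K p c n μ)
    (hmem : ∀ (m : Finset {ℓ // Zhang2014.IsKolyvaginPrime (W.conductorNorm ℤ) W K p ℓ}) (n : Finset (AdmQ W K p)) (μ : Bool),
      ∀ x ∈ S m n μ,
      conjAct W c ((p ^ 1 : ℕ) : ℤ) x = sgnP μ • x ∧
      (∀ v : HeightOneSpectrum (𝓞 K), (∀ ℓ ∈ m, ((ℓ : ℕ) : 𝓞 K) ∉ v.asIdeal) → (∀ q ∈ n, ((q : ℕ) : 𝓞 K) ∉ v.asIdeal) →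
        x ∈ selmerLocalKer (W.baseChange K) (v.adicCompletion K) ((p ^ 1 : ℕ) : ℤ)) ∧
      (∀ w : InfinitePlace K, x ∈ selmerLocalKer (W.baseChange K) w.Completion ((p ^ 1 : ℕ) : ℤ)) ∧
      (∀ q ∈ n, ∀ v : HeightOneSpectrum (𝓞 K), ((q : ℕ) : 𝓞 K) ∈ v.asIdeal →
        x ∈ toricLocalKer (W.baseChange K) (v.adicCompletion K) ((p ^ 1 : ℕ) : ℤ)) ∧
      (∀ ℓ ∈ m, ∀ v : HeightOneSpectrum (𝓞 K), ((ℓ : ℕ) : 𝓞 K) ∈ v.asIdeal → x ∈ transverseLocalKerP W K p ι ℓ v))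
    (hfin : ∀ m n μ, Module.Finite (ZMod p) (S m n μ))
    (huniq : ∀ (ℓ : {ℓ // Zhang2014.IsKolyvaginPrime (W.conductorNorm ℤ) W K p ℓ}) (v v' : HeightOneSpectrum (𝓞 K)),
      ((ℓ : ℕ) : 𝓞 K) ∈ v.asIdeal → ((ℓ : ℕ) : 𝓞 K) ∈ v'.asIdeal → v = v')
    (hZ : ∀ n : Finset (AdmQ W K p), n.Nonempty →
      ∀ (m : Finset {ℓ // Zhang2014.IsKolyvaginPrime (W.conductorNorm ℤ) W K p ℓ}) (ℓ : {ℓ // Zhang2014.IsKolyvaginPrime (W.conductorNorm ℤ) W K p ℓ}) (μ : Bool), ℓ ∉ m →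
      ∀ x : Vp W K p, (∀ v : HeightOneSpectrum (𝓞 K), ((ℓ : ℕ) : 𝓞 K) ∈ v.asIdeal →
        x ∈ (W.baseChange K).torsionLocalKer (v.adicCompletion K) ((p ^ 1 : ℕ) : ℤ)) → (x ∈ S (insert ℓ m) n μ ↔ x ∈ S m n μ))
    (hDet : ∀ n : Finset (AdmQ W K p), n.Nonempty →
      ∀ (m : Finset {ℓ // Zhang2014.IsKolyvaginPrime (W.conductorNorm ℤ) W K p ℓ}) (ℓ : {ℓ // Zhang2014.IsKolyvaginPrime (W.conductorNorm ℤ) W K p ℓ}) (μ : Bool), ℓ ∉ m →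
      (∃ x ∈ S m n μ, ∃ v : HeightOneSpectrum (𝓞 K), ((ℓ : ℕ) : 𝓞 K) ∈ v.asIdeal ∧
        x ∉ (W.baseChange K).torsionLocalKer (v.adicCompletion K) ((p ^ 1 : ℕ) : ℤ)) →
      ∀ y ∈ S (insert ℓ m) n μ, ∀ v : HeightOneSpectrum (𝓞 K), ((ℓ : ℕ) : 𝓞 K) ∈ v.asIdeal →
        y ∈ (W.baseChange K).torsionLocalKer (v.adicCompletion K) ((p ^ 1 : ℕ) : ℤ))
    (hJump : ∀ n : Finset (AdmQ W K p), n.Nonempty →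
      ∀ (m : Finset {ℓ // Zhang2014.IsKolyvaginPrime (W.conductorNorm ℤ) W K p ℓ}) (ℓ : {ℓ // Zhang2014.IsKolyvaginPrime (W.conductorNorm ℤ) W K p ℓ}) (μ : Bool), ℓ ∉ m →
      (∀ x ∈ S m n μ, ∀ v : HeightOneSpectrum (𝓞 K), ((ℓ : ℕ) : 𝓞 K) ∈ v.asIdeal →
        x ∈ (W.baseChange K).torsionLocalKer (v.adicCompletion K) ((p ^ 1 : ℕ) : ℤ)) →
      ∃ y ∈ S (insert ℓ m) n μ, ∃ v : HeightOneSpectrum (𝓞 K), ((ℓ : ℕ) : 𝓞 K) ∈ v.asIdeal ∧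
        y ∉ (W.baseChange K).torsionLocalKer (v.adicCompletion K) ((p ^ 1 : ℕ) : ℤ))
    (hLine : ∀ n : Finset (AdmQ W K p), n.Nonempty →
      ∀ (m : Finset {ℓ // Zhang2014.IsKolyvaginPrime (W.conductorNorm ℤ) W K p ℓ}) (ℓ : {ℓ // Zhang2014.IsKolyvaginPrime (W.conductorNorm ℤ) W K p ℓ}) (μ : Bool),
      ∀ x ∈ S m n μ, (∃ v : HeightOneSpectrum (𝓞 K), ((ℓ : ℕ) : 𝓞 K) ∈ v.asIdeal ∧
        x ∉ (W.baseChange K).torsionLocalKer (v.adicCompletion K) ((p ^ 1 : ℕ) : ℤ)) →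
      ∀ x' ∈ S m n μ, ∃ a : ZMod p, ∀ v : HeightOneSpectrum (𝓞 K), ((ℓ : ℕ) : 𝓞 K) ∈ v.asIdeal →
        x' - a • x ∈ (W.baseChange K).torsionLocalKer (v.adicCompletion K) ((p ^ 1 : ℕ) : ℤ))
    (hCheb1 : ∀ n : Finset (AdmQ W K p), n.Nonempty →
      ∀ (m : Finset {ℓ // Zhang2014.IsKolyvaginPrime (W.conductorNorm ℤ) W K p ℓ}) (μ : Bool), ∀ x ∈ S m n μ, x ≠ 0 →
      ∃ ℓ, ℓ ∉ m ∧ ∃ v : HeightOneSpectrum (𝓞 K), ((ℓ : ℕ) : 𝓞 K) ∈ v.asIdeal ∧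
        x ∉ (W.baseChange K).torsionLocalKer (v.adicCompletion K) ((p ^ 1 : ℕ) : ℤ))
    (hCheb2 : ∀ n : Finset (AdmQ W K p), n.Nonempty →
      ∀ (m : Finset {ℓ // Zhang2014.IsKolyvaginPrime (W.conductorNorm ℤ) W K p ℓ}), ∀ x ∈ S m n true, ∀ y ∈ S m n false,
      x ≠ 0 → y ≠ 0 → ∃ ℓ, ℓ ∉ m ∧
        (∃ v : HeightOneSpectrum (𝓞 K), ((ℓ : ℕ) : 𝓞 K) ∈ v.asIdeal ∧
          x ∉ (W.baseChange K).torsionLocalKer (v.adicCompletion K) ((p ^ 1 : ℕ) : ℤ)) ∧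
        (∃ v : HeightOneSpectrum (𝓞 K), ((ℓ : ℕ) : 𝓞 K) ∈ v.asIdeal ∧
          y ∉ (W.baseChange K).torsionLocalKer (v.adicCompletion K) ((p ^ 1 : ℕ) : ℤ)))
    (hpar : ∀ n : Finset (AdmQ W K p), n.Nonempty → Even n.card →
      Odd (finrank (ZMod p) (SelQP W K p c n true) + finrank (ZMod p) (SelQP W K p c n false)))
    (hdata : ∀ m : Finset {ℓ // Zhang2014.IsKolyvaginPrime (W.conductorNorm ℤ) W K p ℓ},
      Nonempty (KolyvaginHeegnerData Dt β ι (∏ ℓ ∈ m, (ℓ : ℕ))))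
    (hseed : ∃ (m₀ : Finset {ℓ // Zhang2014.IsKolyvaginPrime (W.conductorNorm ℤ) W K p ℓ})
      (d₀ : KolyvaginHeegnerData Dt β ι (∏ ℓ ∈ m₀, (ℓ : ℕ))), d₀.kolyvaginClass (Fact.out : p.Prime) 1 ≠ 0) :
    Nonempty (LevelKolyvaginSystemP W K p Dt β ι c) := by
  classical
  have hp : p.Prime := Fact.out
  -- «vanishing above ℓ» as a subspace
  let Z : {ℓ // Zhang2014.IsKolyvaginPrime (W.conductorNorm ℤ) W K p ℓ} → Submodule (ZMod p) (Vp W K p) := fun ℓ ↦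
    ⨅ (v : HeightOneSpectrum (𝓞 K)) (_ : ((ℓ : ℕ) : 𝓞 K) ∈ v.asIdeal),
      AddSubgroup.toZModSubmodule p ((W.baseChange K).torsionLocalKer (v.adicCompletion K) ((p ^ 1 : ℕ) : ℤ))
  have hZmem : ∀ (ℓ : {ℓ // Zhang2014.IsKolyvaginPrime (W.conductorNorm ℤ) W K p ℓ}) (x : Vp W K p), x ∈ Z ℓ ↔ ∀ v : HeightOneSpectrum (𝓞 K), ((ℓ : ℕ) : 𝓞 K) ∈ v.asIdeal →
      x ∈ (W.baseChange K).torsionLocalKer (v.adicCompletion K) ((p ^ 1 : ℕ) : ℤ) := by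
    intro ℓ x
    simp only [Z, Submodule.mem_iInf, AddSubgroup.mem_toZModSubmodule]
  have hZnot : ∀ (ℓ : {ℓ // Zhang2014.IsKolyvaginPrime (W.conductorNorm ℤ) W K p ℓ}) (x : Vp W K p), x ∉ Z ℓ ↔ ∃ v : HeightOneSpectrum (𝓞 K), ((ℓ : ℕ) : 𝓞 K) ∈ v.asIdeal ∧
      x ∉ (W.baseChange K).torsionLocalKer (v.adicCompletion K) ((p ^ 1 : ℕ) : ℤ) := by
    intro ℓ x
    rw [hZmem]
    push Not
    rfl
  -- one place above `ℓ`: membership in `Z ℓ` is membership at any place above `ℓ`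
  have hZv : ∀ (ℓ : {ℓ // Zhang2014.IsKolyvaginPrime (W.conductorNorm ℤ) W K p ℓ}) (x : Vp W K p) (v : HeightOneSpectrum (𝓞 K)), ((ℓ : ℕ) : 𝓞 K) ∈ v.asIdeal →
      (x ∈ Z ℓ ↔ x ∈ (W.baseChange K).torsionLocalKer (v.adicCompletion K) ((p ^ 1 : ℕ) : ℤ)) := by
    intro ℓ x v hv
    rw [hZmem]
    refine ⟨fun h ↦ h v hv, fun h v' hv' ↦ ?_⟩
    rw [huniq ℓ v' v hv' hv]
    exact h
  -- the abstract twin-dichotomy hypotheses at a non-empty level `n`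
  have HZ : ∀ n : Finset (AdmQ W K p), n.Nonempty → ∀ m ℓ μ, ℓ ∉ m → S (insert ℓ m) n μ ⊓ Z ℓ = S m n μ ⊓ Z ℓ := by
    intro n hn m ℓ μ hℓ
    ext x
    simp only [Submodule.mem_inf]
    constructor
    · rintro ⟨hx, hz⟩
      exact ⟨(hZ n hn m ℓ μ hℓ x ((hZmem ℓ x).mp hz)).mp hx, hz⟩
    · rintro ⟨hx, hz⟩
      exact ⟨(hZ n hn m ℓ μ hℓ x ((hZmem ℓ x).mp hz)).mpr hx, hz⟩
  have HDet : ∀ n : Finset (AdmQ W K p), n.Nonempty → ∀ m ℓ μ, ℓ ∉ m → (∃ x ∈ S m n μ, x ∉ Z ℓ) →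
      S (insert ℓ m) n μ ≤ Z ℓ := by
    intro n hn m ℓ μ hℓ hx y hy
    obtain ⟨x, hxS, hxZ⟩ := hx
    exact (hZmem ℓ y).mpr (hDet n hn m ℓ μ hℓ ⟨x, hxS, (hZnot ℓ x).mp hxZ⟩ y hy)
  have HJump : ∀ n : Finset (AdmQ W K p), n.Nonempty → ∀ m ℓ μ, ℓ ∉ m → S m n μ ≤ Z ℓ →
      ∃ y ∈ S (insert ℓ m) n μ, y ∉ Z ℓ := by
    intro n hn m ℓ μ hℓ hle
    obtain ⟨y, hyS, hy⟩ := hJump n hn m ℓ μ hℓ (fun x hx ↦ (hZmem ℓ x).mp (hle hx))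
    exact ⟨y, hyS, (hZnot ℓ y).mpr hy⟩
  have HLine : ∀ n : Finset (AdmQ W K p), n.Nonempty → ∀ m ℓ μ, ∀ x ∈ S m n μ, x ∉ Z ℓ → ∀ x' ∈ S m n μ,
      ∃ a : ZMod p, x' - a • x ∈ Z ℓ := by
    intro n hn m ℓ μ x hx hxZ x' hx'
    obtain ⟨a, ha⟩ := hLine n hn m ℓ μ x hx ((hZnot ℓ x).mp hxZ) x' hx'
    exact ⟨a, (hZmem ℓ _).mpr ha⟩
  have HCheb1 : ∀ n : Finset (AdmQ W K p), n.Nonempty → ∀ m μ, ∀ x ∈ S m n μ, x ≠ 0 → ∃ ℓ, ℓ ∉ m ∧ x ∉ Z ℓ := by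
    intro n hn m μ x hx hx0
    obtain ⟨ℓ, hℓ, h⟩ := hCheb1 n hn m μ x hx hx0
    exact ⟨ℓ, hℓ, (hZnot ℓ x).mpr h⟩
  have HCheb2 : ∀ n : Finset (AdmQ W K p), n.Nonempty → ∀ m, ∀ x ∈ S m n true, ∀ y ∈ S m n false, x ≠ 0 → y ≠ 0 →
      ∃ ℓ, ℓ ∉ m ∧ x ∉ Z ℓ ∧ y ∉ Z ℓ := by
    intro n hn m x hx y hy hx0 hy0
    obtain ⟨ℓ, hℓ, h₁, h₂⟩ := hCheb2 n hn m x hx y hy hx0 hy0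
    exact ⟨ℓ, hℓ, (hZnot ℓ x).mpr h₁, (hZnot ℓ y).mpr h₂⟩
  have Hfin : ∀ (n : Finset (AdmQ W K p)) (m : Finset {ℓ // Zhang2014.IsKolyvaginPrime (W.conductorNorm ℤ) W K p ℓ})
      (μ : Bool), Module.Finite (ZMod p) ((fun m μ ↦ S m n μ) m μ) := fun n m μ ↦ hfin m n μ
  -- the canonical lines, level by level
  have hcan := fun n : Finset (AdmQ W K p) ↦ CanonicalLines.exists_canonicalLines (fun m μ ↦ S m n μ) (Hfin n)
  choose κc hκc1 hκc0 using hcan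
  -- the seed
  obtain ⟨m₀, d₀, hd₀⟩ := hseed
  -- the classes: the frame's at level `∅` (the seed's datum at its conductor), canonical lines above
  let κ₀ : Finset {ℓ // Zhang2014.IsKolyvaginPrime (W.conductorNorm ℤ) W K p ℓ} → Finset (AdmQ W K p) → Vp W K p :=
    fun m n ↦ if n = ∅ then (if m = m₀ then d₀.kolyvaginClass hp 1 else (Classical.choice (hdata m)).kolyvaginClass hp 1)
      else κc n m
  have hκ₀ : ∀ n : Finset (AdmQ W K p), n.Nonempty → ∀ m, κ₀ m n = κc n m := by
    intro n hn m
    simp only [κ₀, if_neg hn.ne_empty]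
  -- the signs: the odd-rank sign at conductor `∅`
  let ε₀ : Finset (AdmQ W K p) → Bool := fun n ↦ decide (Odd (finrank (ZMod p) (S ∅ n true)))
  -- at a non-empty level every class is `0` or a member of a mixed space
  have hκmem : ∀ n : Finset (AdmQ W K p), n.Nonempty → ∀ m, κ₀ m n = 0 ∨
      (finrank (ZMod p) (S m n true) + finrank (ZMod p) (S m n false) = 1 ∧ ∃ μ, κ₀ m n ∈ S m n μ ∧ κ₀ m n ≠ 0) := by
    intro n hn m
    rw [hκ₀ n hn m]
    by_cases h1 : finrank (ZMod p) (S m n true) + finrank (ZMod p) (S m n false) = 1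
    · exact Or.inr ⟨h1, hκc1 n m h1⟩
    · exact Or.inl (hκc0 n m h1)
  -- `Nat.bodd` in `Even` currency
  have hbodd : ∀ k : ℕ, Nat.bodd k = decide (¬ Even k) := by
    intro k
    have h2 := Nat.mod_two_of_bodd k
    cases hb : Nat.bodd k
    · rw [hb] at h2
      have hk : Even k := Nat.even_iff.mpr (by simpa using h2)
      simp [hk]
    · rw [hb] at h2
      have hk : ¬ Even k := fun he ↦ by
        have h0 := Nat.even_iff.mp he
        rw [h0] at h2
        simp at h2
      simp [hk]
  -- odd total rank at conductor `∅` of a non-empty even level, in `S`-currency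
  have hodd : ∀ n : Finset (AdmQ W K p), n.Nonempty → Even n.card →
      Odd (finrank (ZMod p) (S ∅ n true) + finrank (ZMod p) (S ∅ n false)) := by
    intro n hn he
    rw [hS0, hS0]
    exact hpar n hn he
  refine nonempty_levelKolyvaginSystemP_of_evenLevels W K p c Dt β ι ε₀ κ₀ ?_ ?_ ?_ ?_ ?_ ?_ ?_ ?_ ?_
  · -- realisation at level `∅`
    intro m
    by_cases hm : m = m₀
    · subst hm
      exact ⟨d₀, by simp only [κ₀, if_true]⟩
    · exact ⟨Classical.choice (hdata m), by simp only [κ₀, if_true, if_neg hm]⟩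
  · -- sign: the canonical line at a core `m` has sign `ε₀ n xor bodd #m`
    intro n hn he m
    rcases hκmem n hn m with h0 | ⟨h1, μ, hμ, hne0⟩
    · rw [h0, map_zero, zsmul_zero]
    · have hsgn := (hmem m n μ _ hμ).1
      have hc := CanonicalLines.odd_finrank_empty_iff_even_card_of_core (fun m μ ↦ S m n μ) Z (HZ n hn) (HDet n hn)
        (HJump n hn) (HLine n hn) (Hfin n) h1 hμ hne0
      have hpar' : Odd (finrank (ZMod p) (S ∅ n true)) ↔ Even (finrank (ZMod p) (S ∅ n false)) :=
        Nat.odd_add.mp (hodd n hn he)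
      have key : (ε₀ n ^^ Nat.bodd m.card) = μ := by
        cases μ
        · -- sign `−`: `Odd (dim S ∅ n false) ↔ Even #m`
          change Odd (finrank (ZMod p) (S ∅ n false)) ↔ Even m.card at hc
          by_cases hem : Even m.card
          · have hT : ¬ Odd (finrank (ZMod p) (S ∅ n true)) := fun h ↦
              (Nat.not_even_iff_odd.mpr (hc.mpr hem)) (hpar'.mp h)
            simp [ε₀, hbodd, hem, hT]
          · have hT : Odd (finrank (ZMod p) (S ∅ n true)) :=
              hpar'.mpr (Nat.not_odd_iff_even.mp (fun h ↦ hem (hc.mp h)))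
            simp [ε₀, hbodd, hem, hT]
        · change Odd (finrank (ZMod p) (S ∅ n true)) ↔ Even m.card at hc
          by_cases hem : Even m.card
          · have hT : Odd (finrank (ZMod p) (S ∅ n true)) := hc.mpr hem
            simp [ε₀, hbodd, hem, hT]
          · have hT : ¬ Odd (finrank (ZMod p) (S ∅ n true)) := fun h ↦ hem (hc.mp h)
            simp [ε₀, hbodd, hem, hT]
      rw [key]
      exact hsgn
  · -- selmer_off
    intro n hn he m v hvm hvn
    rcases hκmem n hn m with h0 | ⟨-, μ, hμ, -⟩
    · rw [h0]; exact zero_mem _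
    · exact (hmem m n μ _ hμ).2.1 v hvm hvn
  · -- selmer_inf
    intro n hn he m w
    rcases hκmem n hn m with h0 | ⟨-, μ, hμ, -⟩
    · rw [h0]; exact zero_mem _
    · exact (hmem m n μ _ hμ).2.2.1 w
  · -- toric_on
    intro n hn he m q hq v hv
    rcases hκmem n hn m with h0 | ⟨-, μ, hμ, -⟩
    · rw [h0]; exact zero_mem _
    · exact (hmem m n μ _ hμ).2.2.2.1 q hq v hv
  · -- transverse_on
    intro n hn he m ℓ hℓ v hv
    rcases hκmem n hn m with h0 | ⟨-, μ, hμ, -⟩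
    · rw [h0]; exact zero_mem _
    · exact (hmem m n μ _ hμ).2.2.2.2 ℓ hℓ v hv
  · -- relation (8.1): canonical lines + one place above ℓ
    intro n hn he m ℓ hℓ v hv
    rw [hκ₀ n hn, hκ₀ n hn, ← hZv ℓ _ v hv, ← hZv ℓ _ v hv]
    exact CanonicalLines.mem_iff_mem_of_canonicalLines (fun m μ ↦ S m n μ) Z (HZ n hn) (HDet n hn) (HJump n hn)
      (HLine n hn) (Hfin n) (hκc1 n) (hκc0 n) hℓ
  · -- transport: the seed at level `∅`, core descent at even non-empty levels
    intro n q₁ q₂ hq₁ hq₂ he _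
    by_cases hn : n = ∅
    · subst hn
      exact ⟨m₀, by simpa only [κ₀, if_true] using hd₀⟩
    · have hne : n.Nonempty := Finset.nonempty_iff_ne_empty.mpr hn
      obtain ⟨m, -, hm⟩ := CanonicalLines.exists_core_superset_of_odd (fun m μ ↦ S m n μ) Z (HZ n hne) (HDet n hne)
        (HJump n hne) (HLine n hne) (Hfin n) (HCheb1 n hne) (HCheb2 n hne) (m₀ := ∅) (hodd n hne he)
      obtain ⟨μ, -, hne0⟩ := hκc1 n m hm
      exact ⟨m, by rw [hκ₀ n hne]; exact hne0⟩
  · -- base case: a core's canonical line is non-zero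
    intro n hn he h1
    rw [← hS0, ← hS0] at h1
    obtain ⟨μ, -, hne0⟩ := hκc1 n ∅ h1
    rw [hκ₀ n hn]
    exact hne0

end Summit.BirchSwinnertonDyer.BirchSwinnertonDyer.Theorems.AdditiveKoly

end
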